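import Summits.QuantumFields.YangMills.Theorems.UnitScaleTiltHistoryTailOfPackagePinnedLfCrux
import Summits.QuantumFields.YangMills.Theorems.UV3PinnedStepOrganOfMassEnvelope
import Summits.QuantumFields.YangMills.Theorems.UV3UnitEnvelopeOrganOfMassEnvelope
import HarnessLib

/-!
# THE 19936 CRUX FACE OF RECORD (★★OWNER WORDS 57∕58): `UnitScaleTilt.HistoryTailL` FROM THE v1 T3 (α) SOCKET (GUARDED `∀ L, 1 < L → AlphaInputsT3AC L`), THE POLYMER FIELDS,
# THE EX-LANE MAIN-TERM ROW `hMain`, AND ONE UV3-NODE RESIDUAL: THE TOP-LEVEL A.E. MASS ENVELOPE hJ (+ the trivial history's envelope hTriv, v1 currency)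

Cell `ym3-torus` (YM ladder rung R3 = continuum `SU(2)` Yang–Mills on the three-torus — a RUNG, NOT d = 4, NOT infinite volume, NOT a mass gap, NOT Clay).
Twin-width seat `ym-ust-19936-w8` (gen 11); `--supports stmt-QuantumFields-19936 --as helper`, count-neutral, definition-free, default heartbeats.
Crux `UnitScaleTilt.HistoryTailL` (stmt-QuantumFields-19936), skeleton of record `Cruxes/HistoryTailL/Lines/pinned_stability.lean` v3 (de3325bf, ideator `ym-r3-idea-2` g17, R-a′ letters);
LEAD ★`ym-ust-19936-w1` g11 «GO» 2026-08-29T23:26:59Z; ★★OWNER WORDS 57∕58 (display letter = the residual rows of `ym-ust-19936-w6` g7's LOCATE-S-ORGAN, i.e. hJ).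
**A CONDITIONAL THEOREM WITH DISPLAYED ROWS.  IT DOES NOT PROVE `HistoryTailL`.**

§1 — GUARDED SOCKET TWINS (cure of ideator g17's 2026-08-30T00:35:41Z typing note: the socket binder `∀ L, AlphaInputsT3AC L` of ✓`UV3PinnedStepV3FaceOfPackage` ∕ ✓`UV3UnitDensityUpperOfPackage` §4–§5 ∕
✓`UnitScaleTiltHistoryTailOfPackagePinnedLf` §2 ∕ ✓`UnitScaleTiltHistoryTailOfPackagePinnedLfCrux` is REFUTABLE — `AlphaInputsT3AC L` is false for `L ≤ 1` since `AlphaConsts.one_lt_L` —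
so those prefix-level faces were vacuous as faces; their per-`(F, γ)` lemmas are untouched): `stub_unitEnvelope_of_package_of_lf_ae_of_main'`, `stub_pinnedStepV3_of_package_of_purePinTop_of_main'`,
`pinnedHeightTail_of_package_of_pinnedLF_of_lf_ae_of_main'`, `historyTailL_of_package_of_pinnedLF_of_lf_ae_of_main'` — same statements with `hpkg : ∀ L, 1 < L → AlphaInputsT3AC L`
(the proofs call the socket only at a family's `L = F.L > 1`; block sizes `L ≤ 1` carry no `T3Family` and are served vacuously, as in ✓`UV3UnitEnvelopeFaceOfPackageV3`).
§2 — THE FACE: ★★★★ `historyTailL_of_package_of_massEnvelope_of_main (hpkg) (π) (hMain) (hJ) (hTriv) : …Theses.UnitScaleTilt.HistoryTailL` — by kernel, `HistoryTailL` ⟸ the UV3 node's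
v1 (α) socket ∧ polymer fields ∧ `hMain` ([Balaban1985Variational] Thm 1 (8), the EX lane) ∧ **hJ** (the K-fold transported history masses of `blockAvg ℰp` are essentially bounded at the unit
lattice, K-uniformly, on admissible non-trivial histories — print's Haar-compatibility fact, OPEN for `ℰp`, lit GAPS G-B10-10(c)) ∧ **hTriv** (the trivial history's envelope; an artefact of
the v1 masses' floor, absent in the v3 currency).  Everything else — pinned (41) above the pin (`ym3-torus-px8` BRICKS A∕B2a∕B2b∕C + S-KNIT), the enveloped pinned∕un-pinned resummations
(w6 FILES 1–3c, §U), (46), (47), remainder, profile reduction, envelope exchange, the rate-blind door, the K-19′ socket — is discharged BY NAME underneath.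

HONEST SCOPE.  Faces and guards; nothing of hJ, hTriv, `hMain`, the (α) package, `stub_pinnedStep`, `stub_unitEnvelope`, `hP′`, `HistoryTailL` (19936) or the rung is proved here.
Sorry-free, axioms standard.

References: T. Bałaban, *Ultraviolet stability of three-dimensional lattice pure gauge field theories*, Commun. Math. Phys. **102** (1985) 255–275
[Balaban1985UV3] ((2) p.256, (5)–(7) pp.256–257, (41) p.266, (46)–(47) p.267, (64) p.273, (67), (70)–(71) p.273, pp.273–274); T. Bałaban, Commun. Math. Phys. **102** (1985)
277–309 [Balaban1985Variational] (Thm 1 (8) p.279).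
-/

set_option autoImplicit false

noncomputable section

namespace Summit.QuantumFields.YangMills.Theorems.UnitScaleTiltHistoryTailOfPackageMassEnvelope

open scoped BigOperators
open MeasureTheory
open Literature.MathematicalPhysics.QuantumFieldTheory.Balaban1983to89
open Literature.MathematicalPhysics.QuantumFieldTheory.Balaban1983to89.T3ContinuumYM3Torus
open Literature.MathematicalPhysics.QuantumFieldTheory.Balaban1983to89.T3UnitScaleTilt
open Literature.MathematicalPhysics.QuantumFieldTheory.Balaban1983to89.T3UnitLawDensityEML
open Literature.MathematicalPhysics.QuantumFieldTheory.Balaban1983to89.T3RestrictedUnitDensity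
open Literature.MathematicalPhysics.QuantumFieldTheory.Balaban1983to89.T3AlphaInputsAC
open Literature.MathematicalPhysics.QuantumFieldTheory.Balaban1983to89.Missing (partitionFn)
open Literature.MathematicalPhysics.QuantumFieldTheory.Balaban1985CMP102
open Literature.MathematicalPhysics.QuantumFieldTheory.Balaban1985CMP102.Setting
open Summit.QuantumFields.Balaban3D.Carriers
open Summit.QuantumFields.Balaban3D.Proofs.Primitives
open Summit.QuantumFields.Balaban3D.Proofs.StandardAC
open Summit.QuantumFields.Balaban3D.Proofs.InputsAC
open Summit.QuantumFields.YangMills.Theorems.UV3UnitPartitionLowerOfPackageV3 (exp_Ecst_le_partitionFn_of_packageV3)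
open Summit.QuantumFields.YangMills.Theorems.UV3PinnedStepOfAnchored (ae_resDensity_le_envelope_of_anchored)
open Summit.QuantumFields.YangMills.Theorems.UV3PinnedStepProfileReduction (anchoredStep_of_purePin_floor)
open Summit.QuantumFields.YangMills.Theorems.UV3PinnedStepKnitOfPackage (hPinA_of_pinnedLF)
open Summit.QuantumFields.YangMills.Theorems.UnitScaleTiltHistoryTailOfPackagePinnedLf (pinnedHeightTail_of')
open Summit.QuantumFields.YangMills.Theorems.UnitScaleTiltHistoryTailOfPinnedHeightTailFreeRate (historyTailL_of_pinnedHeightTail_freeRate)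

/-! ## §1 Guarded socket twins of the v1 faces (`∀ L, 1 < L → AlphaInputsT3AC L`) -/

/-- **`PinnedStability.stub_unitEnvelope` (registered text VERBATIM) FROM THE GUARDED v1 SOCKET, `hlf` (a.e.) AND `hMain`** — guarded twin of
✓`UV3UnitDensityUpperOfPackage.stub_unitEnvelope_of_package_of_lf_ae_of_main` (`L ≤ 1` vacuous). [cite: Balaban1985UV3, Thm 1 (5) p.256, (41) p.266, (47) p.267, pp.273–274] -/
theorem stub_unitEnvelope_of_package_of_lf_ae_of_main' (π : ∀ F : T3Family, AlphaInputsT3AC.PolymerT3 F)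
    (hpkg : ∀ L : ℕ, 1 < L → AlphaInputsT3AC L)
    (hlf : ∀ (F : T3Family) (𝔠 : AlphaConsts F.L (suGroupModel 2).N) (h : AlphaInputsT3AC.Of F 𝔠) (γ : ℝ) (hγ : 0 < γ)
      (hγ1 : γ ≤ (min 𝔠.gamma0 1) ^ 2), ∃ CZ : ℝ, ∀ K : ℕ, ∀ᵐ W ∂fieldMeasure (F.P K) K (Matrix.specialUnitaryGroup (Fin 2) ℂ),
        (h.dataT3 γ hγ hγ1 (π F)).LF K K W
            (fun hh => -((h.dataT3 γ hγ hγ1 (π F)).mainT K K hh W) + (h.dataT3 γ hγ hγ1 (π F)).Zterm K K hh) ≤ Real.exp CZ)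
    (hMain : ∀ (F : T3Family) (𝔠 : AlphaConsts F.L (suGroupModel 2).N) (h : AlphaInputsT3AC.Of F 𝔠) (γ : ℝ) (hγ : 0 < γ)
      (hγ1 : γ ≤ (min 𝔠.gamma0 1) ^ 2), ∃ Cm : ℝ, ∀ (K : ℕ) (W : GaugeField (F.P K) K (Matrix.specialUnitaryGroup (Fin 2) ℂ)),
        PlaqSmall (θBal F.L γ 𝔠.b₀ 𝔠.p₀ 0) W →
          (h.dataT3 γ hγ hγ1 (π F)).mainT K K ((h.dataT3 γ hγ hγ1 (π F)).triv K K) W ≤ Cm) :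
    ∀ (L : ℕ), ∃ γ₁ : ℝ, 0 < γ₁ ∧ ∀ (F : T3Family) (γ : ℝ), F.L = L → 0 < γ → γ ≤ γ₁ →
      ∃ Cl : ℝ, ∀ K : ℕ, ∀ᵐ V ∂(fieldMeasure (F.P K) K (Matrix.specialUnitaryGroup (Fin 2) ℂ)),
        emlDensity F γ K K V ≤
          Real.exp Cl * partitionFn (G := Matrix.specialUnitaryGroup (Fin 2) ℂ) (F.P K) ((F.scheme ℰp γ).β K) := by
  intro L
  by_cases hL : 1 < L
  · obtain ⟨𝔠, h𝔠⟩ := hpkg L hL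
    refine ⟨(min 𝔠.gamma0 1) ^ 2, pow_pos (lt_min 𝔠.gamma0_pos one_pos) 2, fun F γ hFL hγ hγle => ?_⟩
    subst hFL
    exact (h𝔠 F rfl).unitEnvelope_letter_of_lf_ae_of_main γ hγ hγle (π F) (hlf F 𝔠 (h𝔠 F rfl) γ hγ hγle)
      (hMain F 𝔠 (h𝔠 F rfl) γ hγ hγle)
  · -- no three-torus family has block size `L ≤ 1`
    exact ⟨1, one_pos, fun F γ hFL _ _ => absurd (hFL ▸ F.hL.2) hL⟩

/-- see the module docstring: guarded twin of ✓`UV3PinnedStepV3FaceOfPackage.stub_pinnedStepV3_of_package_of_purePinTop_of_main`.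
[cite: Balaban1985UV3, (5) p.256, (7) p.257, (41) p.266, (47) p.267, (64) p.273, (70)–(71) p.273] -/
theorem stub_pinnedStepV3_of_package_of_purePinTop_of_main'
    (hpkg : ∀ L : ℕ, 1 < L → AlphaInputsT3AC L)
    (π : ∀ F : T3Family, AlphaInputsT3AC.PolymerT3 F)
    (hMain : ∀ (F : T3Family) (𝔠 : AlphaConsts F.L (suGroupModel 2).N) (h : AlphaInputsT3AC.Of F 𝔠) (γ : ℝ) (hγ : 0 < γ)
      (hγ1 : γ ≤ (min 𝔠.gamma0 1) ^ 2), ∃ Cm : ℝ, ∀ (K : ℕ) (W : GaugeField (F.P K) K (Matrix.specialUnitaryGroup (Fin 2) ℂ)),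
        PlaqSmall (θBal F.L γ 𝔠.b₀ 𝔠.p₀ 0) W →
          (h.dataT3 γ hγ hγ1 (π F)).mainT K K ((h.dataT3 γ hγ hγ1 (π F)).triv K K) W ≤ Cm)
    (hPinA : ∀ (L : ℕ) (𝔠 : AlphaConsts L (suGroupModel 2).N)
      (hOf : ∀ (F : T3Family) (hF : F.L = L), AlphaInputsT3AC.Of F (hF ▸ 𝔠)),
        ∀ (m : ℕ), 0 < m →
          ∃ γ₁ : ℝ, 0 < γ₁ ∧ ∀ (F : T3Family) (hF : F.L = L)
            (γ : ℝ) (hγ : 0 < γ) (hγ1' : γ ≤ (min (hF ▸ 𝔠).gamma0 1) ^ 2), γ ≤ γ₁ →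
            ∃ (Cu c : ℝ) (A : ℕ), 0 < c ∧
              ∀ (K j : ℕ), 1 ≤ j → j + 2 ≤ K → j + (K - 1) / m ≤ K → ∀ (a : Plaq (F.P K) j),
                ∀ᵐ V ∂(fieldMeasure (F.P K) K (Matrix.specialUnitaryGroup (Fin 2) ℂ)),
                  resDensity F γ K
                    {U : GaugeField (F.P K) 0 (Matrix.specialUnitaryGroup (Fin 2) ℂ) |
                      θBal F.L γ (hF ▸ 𝔠).b₀ (hF ▸ 𝔠).p₀ (K - j) ≤ GaugeGroup.dist1 (GaugeField.plaqHol
                        (Averaging.iter (fun i' => BlockAveraging.blockAvg (P := F.P K) (j := i') ℰp) j U) a)}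
                    K V ≤
                  Real.exp (-(((hOf F hF).dataT3 γ hγ hγ1' (π F)).Ecst K K) + Cu) *
                    ((F.scheme ℰp γ).β (K - j) ^ A *
                      Real.exp (-(c * B10.pFun (hF ▸ 𝔠).b₀ (hF ▸ 𝔠).p₀ (Real.sqrt (γ * ((F.L : ℝ)⁻¹) ^ (K - j))) ^ 2)))) :
    ∀ (L : ℕ), ∃ (b₁' p₁' : ℝ), ∀ (b₀ p₀ : ℝ), b₁' ≤ b₀ → p₁' ≤ p₀ → 0 < b₀ → 2 < p₀ → ∀ (m : ℕ), 0 < m →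
      ∃ γ₁ : ℝ, 0 < γ₁ ∧ γ₁ ≤ 1 ∧ ∀ (F : T3Family) (γ : ℝ), F.L = L → 0 < γ → γ ≤ γ₁ →
        ∃ (b p Cu c : ℝ) (A : ℕ), 0 < b ∧ 1 ≤ p ∧ 0 < c ∧ ∀ (K j : ℕ), 1 ≤ j → j + 2 ≤ K → j + (K - 1) / m ≤ K → ∀ (a : Plaq (F.P K) j) (M : ℝ),
          (∀ᵐ V ∂(fieldMeasure (F.P K) K (Matrix.specialUnitaryGroup (Fin 2) ℂ)), emlDensity F γ K K V ≤ M) →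
          ∀ᵐ V ∂(fieldMeasure (F.P K) K (Matrix.specialUnitaryGroup (Fin 2) ℂ)),
            resDensity F γ K
              ({U : GaugeField (F.P K) 0 (Matrix.specialUnitaryGroup (Fin 2) ℂ) |
                  θBal F.L γ b₀ p₀ (K - j) ≤ GaugeGroup.dist1 (GaugeField.plaqHol
                    (Averaging.iter (fun i' => BlockAveraging.blockAvg (P := F.P K) (j := i') ℰp) j U) a)} ∩
                {U : GaugeField (F.P K) 0 (Matrix.specialUnitaryGroup (Fin 2) ℂ) | ∀ i, i < j →
                  PlaqSmall (θBal F.L γ b₀ p₀ (K - i))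
                    (Averaging.iter (fun i' => BlockAveraging.blockAvg (P := F.P K) (j := i') ℰp) i U)})
              K V ≤
            M * Real.exp Cu *
              ((F.scheme ℰp γ).β (K - j) ^ A * Real.exp (-(c * B10.pFun b p (Real.sqrt (γ * ((F.L : ℝ)⁻¹) ^ (K - j))) ^ 2))) := by
  intro L
  by_cases hL : 1 < L
  · obtain ⟨𝔠, hOf⟩ := hpkg L hL
    have HP := hPinA L 𝔠 hOf
    have hγ0 : 0 < (min 𝔠.gamma0 1) ^ 2 := pow_pos (lt_min 𝔠.gamma0_pos one_pos) 2
    refine ⟨𝔠.b₀, 𝔠.p₀, fun b₀ p₀ hbb hpp _ _ m hm => ?_⟩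
    obtain ⟨γ₁, hγ₁, HF⟩ := HP m hm
    refine ⟨min ((min 𝔠.gamma0 1) ^ 2) (min γ₁ 1), lt_min hγ0 (lt_min hγ₁ one_pos), (min_le_right _ _).trans (min_le_right _ _), ?_⟩
    intro F γ hF hγ hγle
    subst hF
    have h : AlphaInputsT3AC.Of F 𝔠 := hOf F rfl
    have hγ1 : γ ≤ (min 𝔠.gamma0 1) ^ 2 := hγle.trans (min_le_left _ _)
    have hγone : γ ≤ 1 := hγle.trans ((min_le_right _ _).trans (min_le_right _ _))
    have hγγ₁ : γ ≤ γ₁ := hγle.trans ((min_le_right _ _).trans (min_le_left _ _))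
    -- the pure-pin row at the package profile, then every steeper profile at the floor rate
    have hPin := HF F rfl γ hγ hγ1 hγγ₁
    obtain ⟨Cu, c, A, hcpos, hstep⟩ :=
      anchoredStep_of_purePin_floor F hγ.le hγone 𝔠.b₀_pos.le (fun K => (h.dataT3 γ hγ hγ1 (π F)).Ecst K K) m hPin hbb hpp
    -- the (47)-half of the v1 socket modulo the main-term row, then the envelope exchange
    obtain ⟨Cl, hlow⟩ := h.exp_Ecst_le_partitionFn_of_package_of_main γ hγ hγ1 (π F) (hMain F 𝔠 h γ hγ hγ1)
    refine ⟨𝔠.b₀, 𝔠.p₀, Cu + Cl, c, A, 𝔠.b₀_pos, by linarith [𝔠.two_lt_p₀], hcpos, fun K j hj1 hjK hjm a M hM => ?_⟩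
    have hw : 0 ≤ (F.scheme ℰp γ).β (K - j) ^ A *
        Real.exp (-(c * B10.pFun 𝔠.b₀ 𝔠.p₀ (Real.sqrt (γ * ((F.L : ℝ)⁻¹) ^ (K - j))) ^ 2)) :=
      mul_nonneg (pow_nonneg (F.scheme_β_nonneg ℰp hγ.le (K - j)) A) (Real.exp_nonneg _)
    exact ae_resDensity_le_envelope_of_anchored F hγ.le K _ hw (hstep K j hj1 hjK hjm a) (hlow K) M hM
  · -- no three-torus family has block size `L ≤ 1`
    refine ⟨1, 1, fun b₀ p₀ _ _ _ _ m _ => ⟨1, one_pos, le_rfl, fun F γ hF _ _ => ?_⟩⟩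
    exact absurd (hF ▸ F.hL.2) hL


open Classical in
/-- **THE PINNED HEIGHT TAIL `hP′` FROM THE GUARDED v1 SOCKET, `π`, `hMain`, `hSii`, `hlf`** — guarded twin of
✓`UnitScaleTiltHistoryTailOfPackagePinnedLf.pinnedHeightTail_of_package_of_pinnedLF_of_lf_ae_of_main`. [cite: Balaban1985UV3, (2) p.256, (6)-(7) p.257, (41) p.266, (47) p.267] -/
theorem pinnedHeightTail_of_package_of_pinnedLF_of_lf_ae_of_main'
    (hpkg : ∀ L : ℕ, 1 < L → AlphaInputsT3AC L)
    (π : ∀ F : T3Family, AlphaInputsT3AC.PolymerT3 F)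
    (hMain : ∀ (F : T3Family) (𝔠 : AlphaConsts F.L (suGroupModel 2).N) (h : AlphaInputsT3AC.Of F 𝔠) (γ : ℝ) (hγ : 0 < γ)
      (hγ1 : γ ≤ (min 𝔠.gamma0 1) ^ 2), ∃ Cm : ℝ, ∀ (K : ℕ) (W : GaugeField (F.P K) K (Matrix.specialUnitaryGroup (Fin 2) ℂ)),
        PlaqSmall (θBal F.L γ 𝔠.b₀ 𝔠.p₀ 0) W →
          (h.dataT3 γ hγ hγ1 (π F)).mainT K K ((h.dataT3 γ hγ hγ1 (π F)).triv K K) W ≤ Cm)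
    (hSii : ∀ (L : ℕ) (𝔠 : AlphaConsts L (suGroupModel 2).N)
      (hOf : ∀ (F : T3Family) (hF : F.L = L), AlphaInputsT3AC.Of F (hF ▸ 𝔠)),
        ∀ (m : ℕ), 0 < m →
          ∃ γ₁ : ℝ, 0 < γ₁ ∧ ∀ (F : T3Family) (hF : F.L = L)
            (γ : ℝ) (hγ : 0 < γ) (hγ1' : γ ≤ (min (hF ▸ 𝔠).gamma0 1) ^ 2), γ ≤ γ₁ →
            ∃ (CZ c : ℝ) (A : ℕ), 0 < c ∧
              ∀ (K j : ℕ) (hj1 : 1 ≤ j) (hjK : j + 2 ≤ K), j + (K - 1) / m ≤ K → ∀ (a : Plaq (F.P K) j),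
                ∀ᵐ W ∂(fieldMeasure (F.P K) K (Matrix.specialUnitaryGroup (Fin 2) ℂ)),
                ∑ r ∈ Finset.univ.filter (fun r : Hist (F.P K) K =>
                    a ∈ r ⟨j, by omega⟩ ∨ ¬ plaqCover a ⊆ Omega (hF ▸ 𝔠).lane.carrier.M₁
                      (rcolOf (T3Scales F γ hγ (hγ1'.trans (sq_min_one_le _ (hF ▸ 𝔠).gamma0_pos)) K) (hF ▸ 𝔠).lane.carrier) j
                      (fun i : Fin j => r (Fin.castLE (by omega) i)) j),
                  (inputOfAC (hF ▸ 𝔠).lane ((hOf F hF).pkgAt γ hγ hγ1' K).X ((hOf F hF).pkgAt γ hγ hγ1' K).𝔖).W.mass K r W *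
                    Real.exp (-(((hOf F hF).pkgAt γ hγ hγ1' K).T.mainT K r W) + ((hOf F hF).pkgAt γ hγ hγ1' K).T.Zterm K r) ≤
                Real.exp CZ * ((F.scheme ℰp γ).β (K - j) ^ A *
                  Real.exp (-(c * B10.pFun (hF ▸ 𝔠).b₀ (hF ▸ 𝔠).p₀ (Real.sqrt (γ * ((F.L : ℝ)⁻¹) ^ (K - j))) ^ 2))))
    (hlf : ∀ (F : T3Family) (𝔠 : AlphaConsts F.L (suGroupModel 2).N) (h : AlphaInputsT3AC.Of F 𝔠) (γ : ℝ) (hγ : 0 < γ)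
      (hγ1 : γ ≤ (min 𝔠.gamma0 1) ^ 2), ∃ CZ : ℝ, ∀ K : ℕ, ∀ᵐ W ∂fieldMeasure (F.P K) K (Matrix.specialUnitaryGroup (Fin 2) ℂ),
        (h.dataT3 γ hγ hγ1 (π F)).LF K K W
            (fun hh => -((h.dataT3 γ hγ hγ1 (π F)).mainT K K hh W) + (h.dataT3 γ hγ hγ1 (π F)).Zterm K K hh) ≤ Real.exp CZ) :
    ∀ (L : ℕ), ∃ (b₁' p₁' : ℝ), ∀ (b₀ p₀ : ℝ), b₁' ≤ b₀ → p₁' ≤ p₀ → 0 < b₀ → 2 < p₀ → ∀ (m : ℕ), 0 < m →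
      ∃ γ₁ : ℝ, 0 < γ₁ ∧ γ₁ ≤ 1 ∧ ∀ (F : T3Family) (γ : ℝ), F.L = L → 0 < γ → γ ≤ γ₁ →
        ∃ (b p C c : ℝ) (A : ℕ), 0 < b ∧ 1 ≤ p ∧ 0 ≤ C ∧ 0 < c ∧
          ∀ (K j : ℕ), 1 ≤ j → j + 2 ≤ K → j + (K - 1) / m ≤ K → ∀ a : Plaq (F.P K) j,
          (gibbsK F ℰp γ K).real
              ({U : GaugeField (F.P K) 0 (Matrix.specialUnitaryGroup (Fin 2) ℂ) |
                  θBal F.L γ b₀ p₀ (K - j) ≤ GaugeGroup.dist1 (GaugeField.plaqHol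
                    (Averaging.iter (fun i' => BlockAveraging.blockAvg (P := F.P K) (j := i') ℰp) j U) a)} ∩
                {U : GaugeField (F.P K) 0 (Matrix.specialUnitaryGroup (Fin 2) ℂ) | ∀ i, i < j →
                  PlaqSmall (θBal F.L γ b₀ p₀ (K - i))
                    (Averaging.iter (fun i' => BlockAveraging.blockAvg (P := F.P K) (j := i') ℰp) i U)}) ≤
            C * (F.scheme ℰp γ).β (K - j) ^ A *
              Real.exp (-(c * B10.pFun b p (Real.sqrt (γ * ((F.L : ℝ)⁻¹) ^ (K - j))) ^ 2)) :=
  pinnedHeightTail_of'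
    (stub_pinnedStepV3_of_package_of_purePinTop_of_main' hpkg π hMain
      (hPinA_of_pinnedLF π fun L 𝔠 hOf m hm => hSii L 𝔠 hOf m hm))
    (stub_unitEnvelope_of_package_of_lf_ae_of_main' π hpkg hlf hMain)

open Classical in
/-- **`UnitScaleTilt.HistoryTailL` FROM THE GUARDED v1 SOCKET, `π`, `hMain`, `hSii`, `hlf`** — guarded twin of
✓`UnitScaleTiltHistoryTailOfPackagePinnedLfCrux.historyTailL_of_package_of_pinnedLF_of_lf_ae_of_main` (CONDITIONAL; closes nothing). [cite: Balaban1985UV3, Thm 1 (5) p.256, (41) p.266, (47) p.267, (70)-(71) p.273] -/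
theorem historyTailL_of_package_of_pinnedLF_of_lf_ae_of_main'
    (hpkg : ∀ L : ℕ, 1 < L → AlphaInputsT3AC L)
    (π : ∀ F : T3Family, AlphaInputsT3AC.PolymerT3 F)
    (hMain : ∀ (F : T3Family) (𝔠 : AlphaConsts F.L (suGroupModel 2).N) (h : AlphaInputsT3AC.Of F 𝔠) (γ : ℝ) (hγ : 0 < γ)
      (hγ1 : γ ≤ (min 𝔠.gamma0 1) ^ 2), ∃ Cm : ℝ, ∀ (K : ℕ) (W : GaugeField (F.P K) K (Matrix.specialUnitaryGroup (Fin 2) ℂ)),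
        PlaqSmall (θBal F.L γ 𝔠.b₀ 𝔠.p₀ 0) W →
          (h.dataT3 γ hγ hγ1 (π F)).mainT K K ((h.dataT3 γ hγ hγ1 (π F)).triv K K) W ≤ Cm)
    (hSii : ∀ (L : ℕ) (𝔠 : AlphaConsts L (suGroupModel 2).N)
      (hOf : ∀ (F : T3Family) (hF : F.L = L), AlphaInputsT3AC.Of F (hF ▸ 𝔠)),
        ∀ (m : ℕ), 0 < m →
          ∃ γ₁ : ℝ, 0 < γ₁ ∧ ∀ (F : T3Family) (hF : F.L = L)
            (γ : ℝ) (hγ : 0 < γ) (hγ1' : γ ≤ (min (hF ▸ 𝔠).gamma0 1) ^ 2), γ ≤ γ₁ →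
            ∃ (CZ c : ℝ) (A : ℕ), 0 < c ∧
              ∀ (K j : ℕ) (hj1 : 1 ≤ j) (hjK : j + 2 ≤ K), j + (K - 1) / m ≤ K → ∀ (a : Plaq (F.P K) j),
                ∀ᵐ W ∂(fieldMeasure (F.P K) K (Matrix.specialUnitaryGroup (Fin 2) ℂ)),
                ∑ r ∈ Finset.univ.filter (fun r : Hist (F.P K) K =>
                    a ∈ r ⟨j, by omega⟩ ∨ ¬ plaqCover a ⊆ Omega (hF ▸ 𝔠).lane.carrier.M₁
                      (rcolOf (T3Scales F γ hγ (hγ1'.trans (sq_min_one_le _ (hF ▸ 𝔠).gamma0_pos)) K) (hF ▸ 𝔠).lane.carrier) j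
                      (fun i : Fin j => r (Fin.castLE (by omega) i)) j),
                  (inputOfAC (hF ▸ 𝔠).lane ((hOf F hF).pkgAt γ hγ hγ1' K).X ((hOf F hF).pkgAt γ hγ hγ1' K).𝔖).W.mass K r W *
                    Real.exp (-(((hOf F hF).pkgAt γ hγ hγ1' K).T.mainT K r W) + ((hOf F hF).pkgAt γ hγ hγ1' K).T.Zterm K r) ≤
                Real.exp CZ * ((F.scheme ℰp γ).β (K - j) ^ A *
                  Real.exp (-(c * B10.pFun (hF ▸ 𝔠).b₀ (hF ▸ 𝔠).p₀ (Real.sqrt (γ * ((F.L : ℝ)⁻¹) ^ (K - j))) ^ 2))))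
    (hlf : ∀ (F : T3Family) (𝔠 : AlphaConsts F.L (suGroupModel 2).N) (h : AlphaInputsT3AC.Of F 𝔠) (γ : ℝ) (hγ : 0 < γ)
      (hγ1 : γ ≤ (min 𝔠.gamma0 1) ^ 2), ∃ CZ : ℝ, ∀ K : ℕ, ∀ᵐ W ∂fieldMeasure (F.P K) K (Matrix.specialUnitaryGroup (Fin 2) ℂ),
        (h.dataT3 γ hγ hγ1 (π F)).LF K K W
            (fun hh => -((h.dataT3 γ hγ hγ1 (π F)).mainT K K hh W) + (h.dataT3 γ hγ hγ1 (π F)).Zterm K K hh) ≤ Real.exp CZ) :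
    Summit.QuantumFields.YangMills.Theses.UnitScaleTilt.HistoryTailL :=
  historyTailL_of_pinnedHeightTail_freeRate (pinnedHeightTail_of_package_of_pinnedLF_of_lf_ae_of_main' hpkg π hMain hSii hlf)

/-! ## §2 THE 19936 CRUX FACE OF RECORD (★★OWNER WORDS 57∕58 letter): `HistoryTailL` ⟸ socket ∧ `π` ∧ `hMain` ∧ hJ ∧ hTriv -/

open Classical in
/-- ★★★★ **`UnitScaleTilt.HistoryTailL` FROM THE v1 T3 (α) SOCKET, THE POLYMER FIELDS, THE EX-LANE MAIN-TERM ROW, AND THE TOP-LEVEL A.E. MASS ENVELOPE hJ (+ the trivial history's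
envelope hTriv)** — the PinnedStability line's crux face with BOTH large-field organs discharged BY NAME down to `ym-ust-19936-w6` g7's residual-designate: `hSii` ⟸ hJ
(✓`UV3PinnedStepOrganOfMassEnvelope.AlphaInputsT3AC.Of.hSii_of_massEnvelope`, FILES 1–3c: the enveloped admissible pinned resummation (67)–(71)+[9] §3.C, collar branch, small factors,
Z-term rate) and `hlf` ⟸ hJ ∧ hTriv (✓`UV3UnitEnvelopeOrganOfMassEnvelope.AlphaInputsT3AC.Of.hlf_ae_of_massEnvelope`, §U), then §1's guarded faces, `ym3-torus-px8` g11's S-KNIT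
✓`hPinA_of_pinnedLF`, the door `pinnedHeightTail_of'` and the LEAD's K-19′ socket.  hJ = «the K-fold transported mass of every admissible non-trivial history is essentially bounded,
uniformly in the run» — in print `≤ 1` by the Haar compatibility of the averaging; OPEN for the tree's `blockAvg ℰp` (lit GAPS G-B10-10(c); the UV3-node residual of record).  hTriv =
the trivial history's mass envelope (v1 currency: the `massRecAC` floor artefact; free in the v3 currency).  **CONDITIONAL — a face; it does NOT prove `HistoryTailL`: hJ, hTriv, the (α)
socket and `hMain` are displayed, not proved.** [cite: Balaban1985UV3, Thm 1 (5) p.256, (41) p.266, (47) p.267, (67), (70)-(71) p.273, pp.273-274; Balaban1985Variational, Thm 1 (8) p.279] -/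
theorem historyTailL_of_package_of_massEnvelope_of_main
    (hpkg : ∀ L : ℕ, 1 < L → AlphaInputsT3AC L)
    (π : ∀ F : T3Family, AlphaInputsT3AC.PolymerT3 F)
    (hMain : ∀ (F : T3Family) (𝔠 : AlphaConsts F.L (suGroupModel 2).N) (h : AlphaInputsT3AC.Of F 𝔠) (γ : ℝ) (hγ : 0 < γ)
      (hγ1 : γ ≤ (min 𝔠.gamma0 1) ^ 2), ∃ Cm : ℝ, ∀ (K : ℕ) (W : GaugeField (F.P K) K (Matrix.specialUnitaryGroup (Fin 2) ℂ)),
        PlaqSmall (θBal F.L γ 𝔠.b₀ 𝔠.p₀ 0) W →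
          (h.dataT3 γ hγ hγ1 (π F)).mainT K K ((h.dataT3 γ hγ hγ1 (π F)).triv K K) W ≤ Cm)
    (hJ : ∀ (F : T3Family) (𝔠 : AlphaConsts F.L (suGroupModel 2).N) (h : AlphaInputsT3AC.Of F 𝔠) (γ : ℝ) (hγ : 0 < γ)
      (hγ1 : γ ≤ (min 𝔠.gamma0 1) ^ 2), ∃ A₁ : ℝ, ∀ (K : ℕ) (r : Hist (F.P K) K),
      Hist.Admissible 𝔠.lane.carrier.M₁ (rcolOf (T3Scales F γ hγ (hγ1.trans (sq_min_one_le _ 𝔠.gamma0_pos)) K) 𝔠.lane.carrier) K r →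
      r ≠ Hist.triv (F.P K) K →
      ∀ᵐ W ∂(fieldMeasure (F.P K) K (Matrix.specialUnitaryGroup (Fin 2) ℂ)),
        (inputOfAC 𝔠.lane (h.pkgAt γ hγ hγ1 K).X (h.pkgAt γ hγ hγ1 K).𝔖).W.mass K r W ≤ Real.exp A₁)
    (hTriv : ∀ (F : T3Family) (𝔠 : AlphaConsts F.L (suGroupModel 2).N) (h : AlphaInputsT3AC.Of F 𝔠) (γ : ℝ) (hγ : 0 < γ)
      (hγ1 : γ ≤ (min 𝔠.gamma0 1) ^ 2), ∃ A₂ : ℝ, ∀ (K : ℕ), ∀ᵐ W ∂(fieldMeasure (F.P K) K (Matrix.specialUnitaryGroup (Fin 2) ℂ)),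
        (inputOfAC 𝔠.lane (h.pkgAt γ hγ hγ1 K).X (h.pkgAt γ hγ hγ1 K).𝔖).W.mass K (Hist.triv (F.P K) K) W ≤ Real.exp A₂) :
    Summit.QuantumFields.YangMills.Theses.UnitScaleTilt.HistoryTailL :=
  historyTailL_of_package_of_pinnedLF_of_lf_ae_of_main' hpkg π hMain
    (fun _ 𝔠 hOf m _ => ⟨1, one_pos, fun F hF γ hγ hγ1' _ =>
      (hOf F hF).hSii_of_massEnvelope γ hγ hγ1' m (hJ F (hF ▸ 𝔠) (hOf F hF) γ hγ hγ1')⟩)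
    (fun F 𝔠 h γ hγ hγ1 => h.hlf_ae_of_massEnvelope γ hγ hγ1 (π F) (hJ F 𝔠 h γ hγ hγ1) (hTriv F 𝔠 h γ hγ hγ1))

end Summit.QuantumFields.YangMills.Theorems.UnitScaleTiltHistoryTailOfPackageMassEnvelope

end
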